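import Mathlib
import Summits.NavierStokesRegularity.FluidComputer.TransportGalerkinFourierCurve
import Summits.NavierStokesRegularity.FluidComputer.TransportGalerkinOneSided
import HarnessLib

/-!
# A classical solution of the perturbed Navier–Stokes system on `𝕋³` IS an `E`-valued solution of the transport Galerkin model (instab g20, cell `ns-blowup`, 2026-08-27)

HONEST FRAMING (human ruling D-0035): nothing here is a claim about Navier–Stokes blow-up.
WHAT THIS IS NOT: not NS evidence — the PDE → lattice transfer of the R-β chain; no flow, certificate,
number or census word moves.

PURPOSE. Composition of the modewise transfer
(`TransportGalerkinFourierTransfer.hasDerivAt_mFourierCoeff_of_perturbationEq`) with the `E`-valued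
derivative of the coefficient curve (`TransportGalerkinFourierCurve.hasDerivAt_coeffCurve`). For a smooth
real host `U` and a perturbation `u : ℝ → 𝕋³ → ℝ³` smooth on `ℝ × 𝕋³` whose slices are divergence free
with vanishing zero mode, satisfying on `(0, T)` the classical perturbation equation
`∂ₜu = νΔu − (U·∇)u − (u·∇)U − (u·∇)u − ∇q` (smooth real pressures `q t`), the scaled coefficient
curve `W s = Λ² 𝓕(u s) ∈ E` (`TransportGalerkin.ofCoeff`):

* `coe_coeffCurve`, `rapidDecay_coeffCurve` — `⇑(W s) = Λ² 𝓕(u s)`, rapidly decreasing;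
* `coeffCurve_clauses` — `W s` is Leray-fixed (`lerayCLM`), real and divergence-free through `proj`
  (the three linear clauses of the chain), from `IsDivFree`, reality of `u` and the zero mode;
* `continuous_coeffCurve` — `W` is continuous into `E`;
* **`hasDerivAt_coeffCurve_nsField`** — for `t ∈ (0, T)`:
  `HasDerivAt W (nsField ν (𝓕 U) proj lerayCLM (W t)) t` IN `E`.

So a classical solution of the perturbed system is EXACTLY the kind of object the chain's KEEP/KILL
and uniqueness theorems quantify over («spatially smooth classical solution of `w' = nsField w`
keeping the clauses»): e.g. `TransportGalerkinAbcSmoothKeep.exists_keep_solution_abc_smooth` (host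
`abcFlow A B C`) now says that any such PDE solution from `ε • v` has `ε e^{μt}/2 ≤ ‖Λ² 𝓕(u t)‖_{ℓ²}`
(the `H²`-type norm of `u t`) on the window, modulo the certificate. `d = 3`; Mathlib + the tree files
cited; no new definitions.
-/

noncomputable section

namespace Summit.NavierStokesRegularity.FluidComputer.TransportGalerkinClassicalTransfer

open Set Filter Topology Finset MeasureTheory UnitAddTorus
open Literature.Analysis.FunctionSpaces Literature.Analysis.FunctionSpaces.Lattice
open Literature.Analysis.FunctionSpaces.Torus Literature.Analysis.FunctionSpaces.EuclideanSpace
open Literature.Analysis.ODE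
open Literature.Analysis.FluidPDE Literature.Analysis.FluidPDE.ScalarFourier
open Summit.NavierStokesRegularity.FluidComputer.GalerkinLatticePhaseSpace
open Summit.NavierStokesRegularity.FluidComputer.TransportGalerkin
open Summit.NavierStokesRegularity.FluidComputer.TransportGalerkinRapid
open Summit.NavierStokesRegularity.FluidComputer.TransportGalerkinAbc
open Summit.NavierStokesRegularity.FluidComputer.TransportGalerkinEigen
open Summit.NavierStokesRegularity.FluidComputer.TransportGalerkinEigenFourier
open Summit.NavierStokesRegularity.FluidComputer.TransportGalerkinOneSided
open Summit.NavierStokesRegularity.FluidComputer.TransportGalerkinFourierTransfer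
open Summit.NavierStokesRegularity.FluidComputer.TransportGalerkinFourierCurve
open scoped ENNReal NNReal ComplexConjugate InnerProductSpace

variable {u : ℝ → UnitAddTorus (Fin 3) → EuclideanSpace ℝ (Fin 3)}

/-! ## §1 The scaled coefficient curve and its clauses -/

/-- Coefficients of the scaled coefficient curve: `⇑(W s) = Λ² 𝓕(u s)`. -/
theorem coe_coeffCurve (hu : IsSmoothSpaceTimeOn univ u) (s : ℝ) :
    ⇑((ofCoeff (wmul 2 (mFourierCoeff (complexify ∘ u s))) : lp (fun _ : (Fin 3 → ℤ) => EuclideanSpace ℂ (Fin 3)) 2)) =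
      wmul 2 (mFourierCoeff (complexify ∘ u s)) :=
  coe_ofCoeff_wmul ((hu.isSmooth_slice (mem_univ s)).complexify_comp.rapidDecay_mFourierCoeff) 2

/-- The scaled coefficient curve is rapidly decreasing at every time. -/
theorem rapidDecay_coeffCurve (hu : IsSmoothSpaceTimeOn univ u) (s : ℝ) :
    RapidDecay (⇑((ofCoeff (wmul 2 (mFourierCoeff (complexify ∘ u s))) :
      lp (fun _ : (Fin 3 → ℤ) => EuclideanSpace ℂ (Fin 3)) 2))) := by
  rw [coe_coeffCurve hu s]
  exact rapidDecay_wmul ((hu.isSmooth_slice (mem_univ s)).complexify_comp.rapidDecay_mFourierCoeff) 2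

/-- **The three linear clauses** of the scaled coefficient curve of a real divergence-free field with
vanishing zero mode: Leray-fixed, real through `proj`, divergence-free through `proj`. -/
theorem coeffCurve_clauses (hu : IsSmoothSpaceTimeOn univ u) (hdiv : ∀ s, IsDivFree (u s))
    (h0 : ∀ s, mFourierCoeff (complexify ∘ u s) 0 = 0) (s : ℝ) :
    (∀ k, lerayCLM k (((ofCoeff (wmul 2 (mFourierCoeff (complexify ∘ u s))) :
        lp (fun _ : (Fin 3 → ℤ) => EuclideanSpace ℂ (Fin 3)) 2) : (Fin 3 → ℤ) → EuclideanSpace ℂ (Fin 3)) k) =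
        ((ofCoeff (wmul 2 (mFourierCoeff (complexify ∘ u s))) :
          lp (fun _ : (Fin 3 → ℤ) => EuclideanSpace ℂ (Fin 3)) 2) : (Fin 3 → ℤ) → EuclideanSpace ℂ (Fin 3)) k) ∧
    (∀ (j : Fin 3) (k : Fin 3 → ℤ), (EuclideanSpace.proj j : EuclideanSpace ℂ (Fin 3) →L[ℂ] ℂ)
        (((ofCoeff (wmul 2 (mFourierCoeff (complexify ∘ u s))) :
          lp (fun _ : (Fin 3 → ℤ) => EuclideanSpace ℂ (Fin 3)) 2) : (Fin 3 → ℤ) → EuclideanSpace ℂ (Fin 3)) (-k)) =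
      conj ((EuclideanSpace.proj j : EuclideanSpace ℂ (Fin 3) →L[ℂ] ℂ)
        (((ofCoeff (wmul 2 (mFourierCoeff (complexify ∘ u s))) :
          lp (fun _ : (Fin 3 → ℤ) => EuclideanSpace ℂ (Fin 3)) 2) : (Fin 3 → ℤ) → EuclideanSpace ℂ (Fin 3)) k))) ∧
    (∀ k : Fin 3 → ℤ, ∑ j, ((k j : ℤ) : ℂ) * (EuclideanSpace.proj j : EuclideanSpace ℂ (Fin 3) →L[ℂ] ℂ)
        (((ofCoeff (wmul 2 (mFourierCoeff (complexify ∘ u s))) :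
          lp (fun _ : (Fin 3 → ℤ) => EuclideanSpace ℂ (Fin 3)) 2) : (Fin 3 → ℤ) → EuclideanSpace ℂ (Fin 3)) k) = 0) := by
  have hus : IsSmooth (u s) := hu.isSmooth_slice (mem_univ s)
  have htr : ∀ k : Fin 3 → ℤ, ∑ j, ((k j : ℤ) : ℂ) * mFourierCoeff (complexify ∘ u s) k j = 0 := fun k =>
    (hdiv s).sum_mul_mFourierCoeff_eq_zero hus k
  rw [coe_coeffCurve hu s]
  refine ⟨fun k => ?_, fun j k => ?_, fun k => ?_⟩
  · rw [wmul_apply, map_smul, lerayCLM_apply_of_transversal htr (h0 s) k]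
  · simp only [wmul_apply, map_smul, smul_eq_mul, map_mul, Complex.conj_ofReal]
    rw [sobolevWeight, freqNormSq_neg, ← sobolevWeight]
    congr 1
    exact mFourierCoeff_complexify_neg_apply hus.integrable k j
  · have h : ∀ j : Fin 3, (EuclideanSpace.proj j : EuclideanSpace ℂ (Fin 3) →L[ℂ] ℂ) (wmul 2 (mFourierCoeff (complexify ∘ u s)) k) =
        (sobolevWeight 2 k : ℂ) * mFourierCoeff (complexify ∘ u s) k j := fun j => by
      rw [wmul_apply, map_smul, smul_eq_mul]; rfl
    simp only [h]
    calc ∑ j, ((k j : ℤ) : ℂ) * ((sobolevWeight 2 k : ℂ) * mFourierCoeff (complexify ∘ u s) k j)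
        = (sobolevWeight 2 k : ℂ) * ∑ j, ((k j : ℤ) : ℂ) * mFourierCoeff (complexify ∘ u s) k j := by
          rw [Finset.mul_sum]; exact Finset.sum_congr rfl fun j _ => by ring
      _ = 0 := by rw [htr k, mul_zero]

/-- The scaled coefficient curve is continuous into `E` (it is differentiable everywhere). -/
theorem continuous_coeffCurve (hu : IsSmoothSpaceTimeOn univ u) :
    Continuous fun s => (ofCoeff (wmul 2 (mFourierCoeff (complexify ∘ u s))) :
      lp (fun _ : (Fin 3 → ℤ) => EuclideanSpace ℂ (Fin 3)) 2) :=
  continuous_iff_continuousAt.2 fun t => (hasDerivAt_coeffCurve hu t).continuousAt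

/-! ## §2 The `E`-valued equation -/

/-- **A classical solution of the perturbed system is an `E`-valued solution of the model**
(`hasDerivAt_coeffCurve_nsField`). Host `U` smooth real; `u` smooth on `ℝ × 𝕋³` with divergence-free
slices of vanishing zero mode; at time `t` the classical perturbation equation holds pointwise with a
smooth real pressure `q`. Then the scaled coefficient curve `W s = Λ² 𝓕(u s)` satisfies
`HasDerivAt W (nsField ν (𝓕 U) proj lerayCLM (W t)) t` in `E`. -/
theorem hasDerivAt_coeffCurve_nsField {ν : ℝ} {U : UnitAddTorus (Fin 3) → EuclideanSpace ℝ (Fin 3)}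
    (hU : IsSmooth U) (hu : IsSmoothSpaceTimeOn univ u)
    (hdiv : ∀ s, IsDivFree (u s)) (h0 : ∀ s, mFourierCoeff (complexify ∘ u s) 0 = 0)
    {q : UnitAddTorus (Fin 3) → ℝ} (hq : IsSmooth q) {t : ℝ}
    (heq : ∀ y, Torus.timeDeriv u t y = ν • laplacian (u t) y
      - (Torus.convect U (u t) y + Torus.convect (u t) U y) - Torus.convect (u t) (u t) y - Torus.gradient q y) :
    HasDerivAt (fun s => (ofCoeff (wmul 2 (mFourierCoeff (complexify ∘ u s))) :
        lp (fun _ : (Fin 3 → ℤ) => EuclideanSpace ℂ (Fin 3)) 2))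
      (nsField ν (mFourierCoeff (complexify ∘ U)) (fun j => (EuclideanSpace.proj j : EuclideanSpace ℂ (Fin 3) →L[ℂ] ℂ))
        lerayCLM (ofCoeff (wmul 2 (mFourierCoeff (complexify ∘ u t))))) t := by
  have hUr : RapidDecay (mFourierCoeff (complexify ∘ U)) := hU.complexify_comp.rapidDecay_mFourierCoeff
  have hur : RapidDecay (mFourierCoeff (complexify ∘ u t)) := (hu.isSmooth_slice (mem_univ t)).complexify_comp.rapidDecay_mFourierCoeff
  have hdr : RapidDecay (mFourierCoeff (complexify ∘ Torus.timeDeriv u t)) :=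
    (hu.timeDeriv.isSmooth_slice (mem_univ t)).complexify_comp.rapidDecay_mFourierCoeff
  refine (hasDerivAt_coeffCurve hu t).congr_deriv ?_
  have hW := rapidDecay_coeffCurve hu t
  -- the two sides, coefficient by coefficient
  have e1 : ⇑((ofCoeff (wmul 2 (mFourierCoeff (complexify ∘ Torus.timeDeriv u t))) :
      lp (fun _ : (Fin 3 → ℤ) => EuclideanSpace ℂ (Fin 3)) 2)) = wmul 2 (mFourierCoeff (complexify ∘ Torus.timeDeriv u t)) :=
    coe_ofCoeff_wmul hdr 2
  have e3 := coe_linOp_of_rapidDecay (ν := ν) hUr (π := fun j => (EuclideanSpace.proj j : EuclideanSpace ℂ (Fin 3) →L[ℂ] ℂ))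
    norm_lerayCLM_le hW
  have e4 := coe_bilOp_of_rapidDecay (π := fun j => (EuclideanSpace.proj j : EuclideanSpace ℂ (Fin 3) →L[ℂ] ℂ))
    norm_lerayCLM_le hW hW
  have e5 : wmul (-2) (⇑((ofCoeff (wmul 2 (mFourierCoeff (complexify ∘ u t))) :
      lp (fun _ : (Fin 3 → ℤ) => EuclideanSpace ℂ (Fin 3)) 2))) = mFourierCoeff (complexify ∘ u t) := by
    rw [coe_coeffCurve hu t, wmul_neg_two_wmul_two]
  rw [e5] at e3 e4
  -- the modewise transfer versus the slice derivative: same derivative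
  have e6 : ∀ k, mFourierCoeff (complexify ∘ Torus.timeDeriv u t) k =
      lerayCLM k (linCoeff ν (mFourierCoeff (complexify ∘ U)) (fun j => (EuclideanSpace.proj j : EuclideanSpace ℂ (Fin 3) →L[ℂ] ℂ))
          (mFourierCoeff (complexify ∘ u t)) k) +
        lerayCLM k (bilCoeff (fun j => (EuclideanSpace.proj j : EuclideanSpace ℂ (Fin 3) →L[ℂ] ℂ))
          (mFourierCoeff (complexify ∘ u t)) (mFourierCoeff (complexify ∘ u t)) k) := fun k => by
    rw [← map_add]
    exact (Torus.hasDerivAt_mFourierCoeff_slice hu k t).unique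
      (hasDerivAt_mFourierCoeff_of_perturbationEq hU hu hdiv h0 hq heq k)
  refine lp.ext (funext fun k => ?_)
  rw [e1, nsField_eq, lp.coeFn_add, Pi.add_apply, e3, e4, wmul_apply, wmul_apply, wmul_apply, e6 k, smul_add]

end Summit.NavierStokesRegularity.FluidComputer.TransportGalerkinClassicalTransfer

end
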